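import Mathlib.RingTheory.MvPolynomial.Homogeneous
import Mathlib.Data.Nat.Factorial.Basic
import Mathlib.Topology.Algebra.Ring.Basic
import Mathlib.Topology.Order.Basic
import Literature.Computability.AlgebraicComplexity.OrbitClosure
import HarnessLib

/-!
# Apolarity: the action of constant-coefficient differential operators, annihilators, and
# sequential (border) limits of annihilators along an orbit

Topic `Literature/Computability/AlgebraicComplexity`; definition items `defn-apolarAction` (D1) and
`defn-borderApolarLimit` (D2) of route `ValiantsHypothesis/BorderApolarity`
(`stmt-ValiantsHypothesis-5778/5779/5781/5782`), which inline both notions as `let act := …` and as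
the two Kuratowski-limit conjuncts (Li), (Ls). Pure definitions; nothing asserted.

## Contents

* `apolarAction D f` — the **apolarity action** `D ⌟ f` of `D ∈ k[∂₁, …]` (written as an element
  of `MvPolynomial σ k`, `∂ᵉ ↔ Xᵉ`) on `f ∈ k[x₁, …]` by constant-coefficient differential operators:
  `∂ᵉ · xᵈ = (∏_{i ∈ supp e} dᵢ!/(dᵢ − eᵢ)!) x^{d−e}` (zero unless `e ≤ d`), extended bilinearly —
  the derivation form of Macaulay's inverse systems (Iarrobino–Kanev, LNM 1721, §1.1, char `0`
  identification of the divided-power module with the polynomial ring; Landsberg 2017 §10.1.2,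
  "`D ↦ D(f)`"; Buczyńska–Buczyński 2021 §3.1, `Θ ⌟ F`). The body is TOKEN FOR TOKEN the inline
  `act` of the route items, so `act D f` there is `apolarAction D f` by `rfl`.
* `annihilator f = f^{ann} = {D | D ⌟ f = 0}` (Landsberg §10.1.2: "`f^{ann} := {P ∈ ℂ[∂/∂x₁, …,
  ∂/∂xₙ] | P(f) = 0}`") and its degree-`j` piece `annihilatorOfDegree f j = {D | D homogeneous of
  degree j ∧ D ⌟ f = 0}` (`= ker f_{j,d−j}` for a form `f` of degree `d`), in the conjunct order of
  the route items.
* `IsBorderApolarLimit d P J` — **points of the border-apolarity variety written sequentially**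
  (over a topological field `𝕜`, in the route `𝕜 = ℂ`): for a sequence of polynomials `P t` and a
  family `J : ℕ → Set (MvPolynomial σ 𝕜)`, for every degree `k ≤ d` the set `J k` is the
  Kuratowski limit, in the coefficient topology (`coeffVec`), of the annihilator spaces
  `Ann_k(P t)`: (Li) every `D ∈ J k` is a limit of some `D_t ∈ Ann_k(P t)`, and (Ls) every limit
  along a subsequence `φ` of elements of `Ann_k(P (φ t))` lies in `J k` — the sequential
  description of the points of the closure of `{(Ann_k(P))_k}` in the product of Grassmannians /
  multigraded Hilbert scheme along `P_t ∈ GL · P` (Buczyńska–Buczyński 2021 §§3–5: limits of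
  ideals; Haiman–Sturmfels' multigraded Hilbert scheme). Body = the route's conjuncts (Li), (Ls)
  with `act ↦ apolarAction`, so an item `… (Li) ∧ (Ls) …` restates by `Iff.rfl`.

## API (proved)

* `apolarAction_zero_left/right`; on monomials: `apolarAction_monomial_monomial` (the printed
  formula `∂ᵉ xᵈ = (∏ descFactorial) x^{d−e}`) and `apolarAction_monomial_monomial_of_not_le`
  (`= 0` unless `e ≤ d`); `mem_annihilator_iff`, `mem_annihilatorOfDegree_iff`,
  `zero_mem_annihilatorOfDegree`.
* `IsBorderApolarLimit.exists_tendsto` (Li), `.mem_of_tendsto` (Ls), `.zero_mem`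
  (`0 ∈ J k`), and `.isHomogeneous_of_mem` — over a Hausdorff field every `D ∈ J k` is homogeneous
  of degree `k` (coefficients off degree `k` are limits of zeros): the first step of "limits of
  homogeneous ideals are homogeneous ideals with the same Hilbert function".

## Deliberately NOT here (route follow-ups)

* The `k[∂]`-module axioms (`(DE) ⌟ f = D ⌟ (E ⌟ f)`, bilinearity as bundled maps), the ideal
  structure of `annihilator`, `Ann_j = ⊤` for `j > deg f`, perfection of the degree-`d` pairing,
  `GL`-equivariance (`D ⌟ (A·f) = A·((Aᵀ·D) ⌟ f)`); for border limits: `J k` is a subspace of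
  dimension `dim Ann_k(P)` and `(J k)_k` an ideal, sequential compactness of orbit sequences,
  `GL`-equivariance of limits, and "set of limits = Zariski closure of the orbit in `Π_k Gr`"
  (projectivity, needed for the Borel fixed point theorem).

## References

* A. Iarrobino, V. Kanev, *Power sums, Gorenstein algebras, and determinantal loci*, LNM 1721
  (1999), §1.1 (Macaulay's inverse systems; the contraction/derivation actions). [`IarrobinoKanev1999`]
* J. M. Landsberg, *Geometry and complexity theory*, CUP 2017, §10.1.2 "The apolar ideal"
  (PDF p. 282, read). [`LandsbergGCT2017`]
* W. Buczyńska, J. Buczyński, *Apolarity, border rank, and multigraded Hilbert scheme*, Duke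
  Math. J. 170 (2021) = arXiv:1910.01944, §3.1 (the action `⌟`, read: p. 9), §§3.5–5 (limits of
  ideals, slip). [`BuczynskaBuczynski2021`]
-/

noncomputable section

open MvPolynomial Filter
open scoped Topology

namespace Literature.Computability.AlgebraicComplexity

/-! ### The apolarity action -/

section Action

variable {σ : Type*} {k : Type*} [CommRing k]

/-- The **apolarity action** `D ⌟ f` of a constant-coefficient differential operator `D`
(an element of `MvPolynomial σ k` read in the dual variables `∂ᵢ`) on a polynomial `f`:
`D ⌟ f = Σ_{e ∈ supp D} Σ_{d ∈ supp f} D_e f_d (∏_{i ∈ supp e} dᵢ (dᵢ−1) ⋯ (dᵢ−eᵢ+1)) · x^{d−e}`, i.e.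
`∂ᵉ ↦` the differential operator `∂^{|e|}/∂xᵉ` (`∂ᵉ xᵈ = 0` unless `e ≤ d`, the descending
factorial vanishing). Iarrobino–Kanev §1.1 (derivation action, char `0`); Landsberg 2017 §10.1.2
(`D ↦ D(f)`); Buczyńska–Buczyński 2021 §3.1 (`Θ ⌟ F`). Verbatim the inline `act` of route
`BorderApolarity`. [cite: IarrobinoKanev1999, §1.1] -/
def apolarAction (D f : MvPolynomial σ k) : MvPolynomial σ k :=
  ∑ e ∈ D.support, ∑ d ∈ f.support,
    MvPolynomial.monomial (d - e)
      (MvPolynomial.coeff e D * MvPolynomial.coeff d f *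
        ∏ i ∈ e.support, (Nat.descFactorial (d i) (e i) : k))

/-- Unfolding `apolarAction` (the route's inline `act`). [cite: IarrobinoKanev1999, §1.1] -/
theorem apolarAction_def (D f : MvPolynomial σ k) :
    apolarAction D f = ∑ e ∈ D.support, ∑ d ∈ f.support, MvPolynomial.monomial (d - e)
      (MvPolynomial.coeff e D * MvPolynomial.coeff d f *
        ∏ i ∈ e.support, (Nat.descFactorial (d i) (e i) : k)) := rfl

/-- `0 ⌟ f = 0`. [folklore] -/
@[simp] theorem apolarAction_zero_left (f : MvPolynomial σ k) : apolarAction 0 f = 0 := by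
  simp [apolarAction]

/-- `D ⌟ 0 = 0`. [folklore] -/
@[simp] theorem apolarAction_zero_right (D : MvPolynomial σ k) : apolarAction D 0 = 0 := by
  simp [apolarAction]

/-- **The action on monomials**: `(a ∂ᵉ) ⌟ (b xᵈ) = a b (∏_{i ∈ supp e} descFactorial dᵢ eᵢ) x^{d−e}`
(Iarrobino–Kanev §1.1: `∂ᵉ` acts as `∂^{|e|}/∂xᵉ`). [cite: IarrobinoKanev1999, §1.1] -/
theorem apolarAction_monomial_monomial [DecidableEq σ] (e d : σ →₀ ℕ) (a b : k) :
    apolarAction (MvPolynomial.monomial e a) (MvPolynomial.monomial d b) =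
      MvPolynomial.monomial (d - e) (a * b * ∏ i ∈ e.support, (Nat.descFactorial (d i) (e i) : k)) := by
  classical
  by_cases ha : a = 0
  · subst ha
    simp [apolarAction]
  by_cases hb : b = 0
  · subst hb
    simp [apolarAction]
  simp [apolarAction, MvPolynomial.support_monomial, ha, hb]

/-- If `e ≰ d` then `∂ᵉ ⌟ xᵈ = 0`: some `descFactorial dᵢ eᵢ` with `eᵢ > dᵢ` vanishes.
[cite: IarrobinoKanev1999, §1.1] -/
theorem apolarAction_monomial_monomial_of_not_le [DecidableEq σ] {e d : σ →₀ ℕ} (h : ¬ e ≤ d)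
    (a b : k) :
    apolarAction (MvPolynomial.monomial e a) (MvPolynomial.monomial d b) = 0 := by
  rw [apolarAction_monomial_monomial]
  obtain ⟨i, hi⟩ : ∃ i, d i < e i := by
    by_contra hcon
    push Not at hcon
    exact h fun i => hcon i
  have hie : i ∈ e.support := by
    rw [Finsupp.mem_support_iff]
    omega
  have hzero : (Nat.descFactorial (d i) (e i) : k) = 0 := by
    rw [Nat.descFactorial_eq_zero_iff_lt.2 hi, Nat.cast_zero]
  rw [Finset.prod_eq_zero hie hzero, mul_zero, MvPolynomial.monomial_zero]

end Action

/-! ### Annihilators (apolar ideal, as sets) -/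

section Annihilator

variable {σ : Type*} {k : Type*} [CommRing k]

/-- The **annihilator** (apolar ideal, as a set) `f^{ann} = {D | D ⌟ f = 0}` (Landsberg 2017
§10.1.2: "`f^{ann} := {P ∈ ℂ[∂/∂x₁, …, ∂/∂xₙ] | P(f) = 0}`"). The ideal structure is a follow-up.
[cite: LandsbergGCT2017, §10.1.2] -/
def annihilator (f : MvPolynomial σ k) : Set (MvPolynomial σ k) :=
  {D | apolarAction D f = 0}

/-- The **degree-`j` annihilator** `Ann_j(f) = {D | D homogeneous of degree j ∧ D ⌟ f = 0}`
(`= ker f_{j,d−j}`, the kernel of the flattening `S^jV* → S^{d−j}V`, `D ↦ D(f)`, for a form `f` of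
degree `d`; Landsberg 2017 §10.1.2). Conjuncts in the order of the route items. [cite: LandsbergGCT2017, §10.1.2] -/
def annihilatorOfDegree (f : MvPolynomial σ k) (j : ℕ) : Set (MvPolynomial σ k) :=
  {D | D.IsHomogeneous j ∧ apolarAction D f = 0}

/-- Membership in the annihilator. [cite: LandsbergGCT2017, §10.1.2] -/
@[simp] theorem mem_annihilator_iff {f D : MvPolynomial σ k} :
    D ∈ annihilator f ↔ apolarAction D f = 0 := Iff.rfl

/-- Membership in the degree-`j` annihilator. [cite: LandsbergGCT2017, §10.1.2] -/
@[simp] theorem mem_annihilatorOfDegree_iff {f D : MvPolynomial σ k} {j : ℕ} :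
    D ∈ annihilatorOfDegree f j ↔ D.IsHomogeneous j ∧ apolarAction D f = 0 := Iff.rfl

/-- `0 ∈ Ann_j(f)`. [folklore] -/
theorem zero_mem_annihilatorOfDegree (f : MvPolynomial σ k) (j : ℕ) :
    (0 : MvPolynomial σ k) ∈ annihilatorOfDegree f j :=
  ⟨isHomogeneous_zero σ k j, apolarAction_zero_left f⟩

/-- `Ann_j(f) ⊆ f^{ann}`. [cite: LandsbergGCT2017, §10.1.2] -/
theorem annihilatorOfDegree_subset_annihilator (f : MvPolynomial σ k) (j : ℕ) :
    annihilatorOfDegree f j ⊆ annihilator f := fun _ h => h.2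

end Annihilator

/-! ### Sequential border-apolarity limits -/

section Border

variable {σ : Type*} {𝕜 : Type*} [Field 𝕜] [TopologicalSpace 𝕜]

/-- **Border-apolarity limit, sequentially.** `IsBorderApolarLimit d P J`: for every degree
`k ≤ d`, `J k` is the Kuratowski limit — in the topology of coefficientwise convergence
(`coeffVec`) — of the degree-`k` annihilators `Ann_k(P t)` along the sequence `P`:
(Li) every `D ∈ J k` is the limit of a sequence `D_t ∈ Ann_k(P t)`;
(Ls) whenever `D_t ∈ Ann_k(P (φ t))` along a subsequence `φ` (strictly monotone) converge to `D`,
then `D ∈ J k`.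
For `P t ∈ GL · P₀` these are the points of the closure of `{(Ann_k(g·P₀))_{k ≤ d} : g ∈ GL}` in
`Π_k Gr` — the sequential form of the limits of (apolar) ideals of Buczyńska–Buczyński 2021 (§§3.5–5,
in the multigraded Hilbert scheme). Verbatim the conjuncts (Li) ∧ (Ls) of route `BorderApolarity`'s
items with `act ↦ apolarAction`. [cite: BuczynskaBuczynski2021, §§3.5–5 (limits of ideals)] -/
def IsBorderApolarLimit (d : ℕ) (P : ℕ → MvPolynomial σ 𝕜) (J : ℕ → Set (MvPolynomial σ 𝕜)) : Prop :=
  (∀ k ≤ d, ∀ D ∈ J k, ∃ Ds : ℕ → MvPolynomial σ 𝕜,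
      (∀ t, (Ds t).IsHomogeneous k ∧ apolarAction (Ds t) (P t) = 0) ∧
        Filter.Tendsto (fun t => coeffVec (Ds t)) Filter.atTop (nhds (coeffVec D))) ∧
    (∀ k ≤ d, ∀ (D : MvPolynomial σ 𝕜) (φ : ℕ → ℕ) (Ds : ℕ → MvPolynomial σ 𝕜), StrictMono φ →
      (∀ t, (Ds t).IsHomogeneous k ∧ apolarAction (Ds t) (P (φ t)) = 0) →
        Filter.Tendsto (fun t => coeffVec (Ds t)) Filter.atTop (nhds (coeffVec D)) → D ∈ J k)

namespace IsBorderApolarLimit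

variable {d : ℕ} {P : ℕ → MvPolynomial σ 𝕜} {J : ℕ → Set (MvPolynomial σ 𝕜)}

/-- (Li): every element of `J k` is a coefficientwise limit of degree-`k` annihilators of the
`P t`. [cite: BuczynskaBuczynski2021, §§3.5–5] -/
theorem exists_tendsto (h : IsBorderApolarLimit d P J) {k : ℕ} (hk : k ≤ d)
    {D : MvPolynomial σ 𝕜} (hD : D ∈ J k) :
    ∃ Ds : ℕ → MvPolynomial σ 𝕜, (∀ t, Ds t ∈ annihilatorOfDegree (P t) k) ∧
      Filter.Tendsto (fun t => coeffVec (Ds t)) Filter.atTop (nhds (coeffVec D)) :=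
  h.1 k hk D hD

/-- (Ls): every subsequential limit of degree-`k` annihilators lies in `J k`. [cite: BuczynskaBuczynski2021, §§3.5–5] -/
theorem mem_of_tendsto (h : IsBorderApolarLimit d P J) {k : ℕ} (hk : k ≤ d)
    {D : MvPolynomial σ 𝕜} {φ : ℕ → ℕ} {Ds : ℕ → MvPolynomial σ 𝕜} (hφ : StrictMono φ)
    (hDs : ∀ t, Ds t ∈ annihilatorOfDegree (P (φ t)) k)
    (hlim : Filter.Tendsto (fun t => coeffVec (Ds t)) Filter.atTop (nhds (coeffVec D))) :
    D ∈ J k :=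
  h.2 k hk D φ Ds hφ hDs hlim

/-- `0 ∈ J k` for every `k ≤ d` (limit of the zero annihilators along `φ = id`). [folklore] -/
theorem zero_mem (h : IsBorderApolarLimit d P J) {k : ℕ} (hk : k ≤ d) :
    (0 : MvPolynomial σ 𝕜) ∈ J k :=
  h.mem_of_tendsto hk (φ := id) (Ds := fun _ => 0) strictMono_id
    (fun t => zero_mem_annihilatorOfDegree (P t) k) tendsto_const_nhds

/-- **Limits are homogeneous**: over a Hausdorff field, every `D ∈ J k` (`k ≤ d`) is homogeneous
of degree `k` — a coefficient of `D` off degree `k` is the limit of the corresponding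
coefficients of the approximants, which vanish. [cite: BuczynskaBuczynski2021, §§3.5–5] -/
theorem isHomogeneous_of_mem [T2Space 𝕜] (h : IsBorderApolarLimit d P J) {k : ℕ} (hk : k ≤ d)
    {D : MvPolynomial σ 𝕜} (hD : D ∈ J k) : D.IsHomogeneous k := by
  obtain ⟨Ds, hDs, hlim⟩ := h.exists_tendsto hk hD
  -- coefficients off degree `k` vanish
  have hcoeff : ∀ m : σ →₀ ℕ, m.degree ≠ k → MvPolynomial.coeff m D = 0 := by
    intro m hm
    have h1 : Filter.Tendsto (fun t => coeffVec (Ds t) m) Filter.atTop (nhds (coeffVec D m)) :=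
      (continuous_apply m).continuousAt.tendsto.comp hlim
    have h2 : (fun t => coeffVec (Ds t) m) = fun _ => 0 := by
      funext t
      exact (hDs t).1.coeff_eq_zero hm
    rw [h2] at h1
    exact (tendsto_nhds_unique h1 tendsto_const_nhds)
  intro m hm
  by_contra hne
  exact hm (by
    have := hcoeff m (by rwa [Finsupp.degree_eq_weight_one])
    exact this)

end IsBorderApolarLimit

end Border

end Literature.Computability.AlgebraicComplexity
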